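import Summits.QuantumFields.YangMills.Theorems.BalabanUVNodesN07ChartRemainderP
import Summits.QuantumFields.YangMills.Theorems.UnitScaleTiltProp7SymAvgRelativeAnalytic
import HarnessLib

/-!
# BalabanUVNodes ∕ N07 — THE CHARTED MULTI-LEVEL (0.4)-CONSTRAINT `chartLog η D` IS ℂ-ANALYTIC ON THE WEIGHTED BALL (not merely differentiable), hence `C^∞`
# there, and ITS DERIVATIVE IS LIPSCHITZ AT THE ORIGIN — [15] (72) «|𝒞′X| ≤ C₃|X₀||X|», the input of (73) — for the TRUE averaging of [Balaban1987RG1], generic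
# carrier `P : Params` (⇒ NODE 00's T⁴ tori), k-uniform constants

Cell `pub-ymgap`, width seat `pub-ymgap-dag-n07-w2` generation 3 (HUMAN RULING D-0149; DAG node N07 = [15] = [Balaban1985Variational]; W-SEAT START LIST §n07 item 2 = S2
«Prop. 3 at objects», successor piece of files `…N07ChartRemainderP` ∕ `…N07ChartDOfRecord`).  `--kind proof --supports stmt-QuantumFields-20542 --as helper` (K1⁷;
count-neutral; theorems only).

WHY.  [15] Prop. 3 says the chart `D(A′)` is «defined and ANALYTIC», and (73) «|δD(A′)∕δA′| ≤ …» rests on (72) — the derivative bound of the nonlinear part `C` of the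
constraint («Proposition 5 of [4] implies |𝒞′X| ≤ C₃…»).  The K0 heart consumes exactly these: dag k0-s1-w2's bricks 7–8 display `HasFDerivAt D 𝔇 A′`, the letter (73)ᵀ
`θ` and the holomorphy of `D`, and lit-balaban's `B11Prop3Model.norm_fderiv_Dfix_le` produces all three from `Inputs` = {(46) `‖H‖ ≤ B₀`, (44) quad, `ContDiffOn ℂ 1 C`,
(72) `‖DC(Y)‖ ≤ C₃‖Y‖`}.  The route `UnitScaleTilt`'s P3 engine proved the TRUE constraint map `Prop8Chart.chartLog η D` DIFFERENTIABLE on the weighted ball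
(`Prop8ChartDiff ∕ DiffLocal ∕ DiffBall`); Mathlib has no Hartogs∕Osgood theorem turning several-variable ℂ-differentiability into analyticity, so `ContDiffOn` and the
Cauchy estimate for DERIVATIVE DIFFERENCES (`B7TransferAnalyticMean.norm_fderiv_sub_fderiv_le`, which wants `AnalyticOnNhd`) were out of reach.  The route's own
`Prop7SymAvgRelativeBound.analyticAt_coe_emlIterU_family_of_reads` (the engine's induction in ANALYTIC form for any analytic family; `UnitScaleTiltProp7SymAvgRelativeAnalytic`)
is the input THIS FILE reads at the family `A ↦ e^{iηA}` and carries to the charted constraint on the weighted ball, harvesting: analyticity there, `ContDiffOn ℂ ⊤`, and the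
(72)-letter.

CONTENTS.  §1 ★ `analyticAt_coe_emlIterU_of_reads` — `A ↦ Ū^{(i)}(e^{iηA})(e)` is ANALYTIC at every base point whose charted bond variables are within `s₀` of `1` on the read
region, `6400ℓ²Lⁱs₀ ≤ 1` (the route's family theorem BY NAME).  §2 `analyticAt_chartLog_apply_of(_reads)`, `analyticOnNhd_chartLog_of_forall`.  §3 ★★ `analyticOnNhd_chartLog_weightedBall` (collar property; `_of_adm22`): `AnalyticOnNhd ℂ (chartLog η D) {Y | ∀ b, w 1 b·‖Y b‖ < R}`
for `12800ℓ²LR ≤ 1`, weights `K0FlatCubeOpsTextP.IsLevWeight P k D w`, `η = L^{−k}`; ★ `contDiffOn_chartLog_weightedBall` (every order).  §4 ★★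
`norm_fderiv_chartLog_sub_fderiv_zero_le_weightedBall` — THE (72)-LETTER: for `Y` of weighted size `≤ r`, `8r ≤ R′`, `W` of weighted size `≤ ρ`, every index `i`:
`‖(D chartLog(Y) − D chartLog(0)) W i‖ ≤ (3840ℓL∕R′)·ρ·r` (Cauchy estimate through the weighting isomorphism, as in file 3's hCq; constants in `d`, `L` only).

NOT HERE (successor, named): the transport of {hH, hCq, §4, §5} into `B11Prop3Model.Inputs` on the `NegSup`-normed carriers of `FlatChart47Levels` and the resulting
`HasFDerivAt D(·)` with (73) `‖δD∕δA′‖ ≤ 4C₃ε` for file `…ChartDOfRecord`'s `D`; (58).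

HONEST FRAMING: kernel calculus on the tree's own charted averaging; nothing of [15] Sects. D–F asserted; stub 1 ∕ K0⁷ ∕ K1⁷ NOT closed; N07 NOT discharged; counts
unmoved (5∕27); one finite T⁴ programme at fixed ε — NOT continuum ∕ ℝ⁴ ∕ OS ∕ mass gap ∕ Clay: the Yang–Mills mass gap is NOT proved by any of this; R4 closes the conditional
rung `BalabanLadder.UV` only.  No `sorry`, no `def`, no `instance`, no `notation`.

References: [15] T. Bałaban, CMP 102 (1985) 277–309 [Balaban1985Variational] ((44)–(48) p.285, (70)–(73) p.289, Prop. 3 p.289, (156)–(157) p.302); [B7] CMP 98 (1985) 17–51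
[Balaban1985Averaging] (Props. 4–5 pp.38–42, (9) p.18); [I] CMP 109 (1987) 249–301 [Balaban1987RG1] ((0.4) p.253 «Gᶜ-valued … analytic», (0.11), (0.21) pp.253–256).
-/

noncomputable section

open scoped BigOperators
open NormedSpace Metric Set

namespace Summit.QuantumFields.YangMills.BalabanUVNodes.N07ChartLogAnalytic

open Literature.MathematicalPhysics.QuantumFieldTheory.Balaban1983to89
open T4Continuum BlockAveraging AveragingRT ExpMeanLog MatrixLog BlockAveragingEMLLinearised
open B10Eq27TorusAxialLog (holT holT_nil holT_cons_true holT_cons_false)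
open B6SectADomainsV1 (Domains)
open B6SectAOperatorsV1 (BondIdx)
open B5Eq118OneStroke (iterBlockOf iterBlockOf_succ iterBlockOf_zero)
open Summit.QuantumFields.YangMills.Theorems.Prop8Chart
open Summit.QuantumFields.YangMills.Theorems.Prop7SymAvgRelativeBound (analyticAt_coe_expCfg analyticAt_coe_emlIterU_family_of_reads)

variable {P : Params} {j : ℕ}
variable {𝔸 : Type*} [NormedRing 𝔸] [NormedAlgebra ℂ 𝔸] [CompleteSpace 𝔸]
variable {E : Type*} [NormedAddCommGroup E] [NormedSpace ℂ E]

/-! ## §1  The iterated unguarded averages of `e^{iηA}` are ANALYTIC at near-flat base points (the route `UnitScaleTilt`'s analytic induction, BY NAME) -/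

/-- ★ **`A ↦ Ū^{(i)}(e^{iηA})(e)` IS ℂ-ANALYTIC AT EVERY BASE POINT WHOSE CHARTED BOND VARIABLES ARE NEAR-FLAT ON THE READ REGION** (uniform budget
`6400ℓ²Lⁱs₀ ≤ 1`) — the route `UnitScaleTilt`'s family version `Prop7SymAvgRelativeBound.analyticAt_coe_emlIterU_family_of_reads` at the analytic family `A ↦ e^{iηA}`
(`analyticAt_coe_expCfg`), BY NAME. [cite: Balaban1987RG1, (0.4) p.253, (0.21) p.256; Balaban1985Averaging, Prop. 4 p.38] -/
theorem analyticAt_coe_emlIterU_of_reads [NormOneClass 𝔸] (η : ℝ) :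
    ∀ (i : ℕ), i ≤ P.m + P.K → ∀ (S : Set (Site P i)) (A₀ : PBond P 0 → 𝔸) (s₀ : ℝ), 0 ≤ s₀ →
      6400 * (((P.d + 2) * P.L : ℕ) : ℝ) ^ 2 * (P.L : ℝ) ^ i * s₀ ≤ 1 →
      (∀ b : PBond P 0, iterBlockOf i b.src ∈ S → iterBlockOf i b.tgt ∈ S → ‖((expCfg η A₀ b : 𝔸ˣ) : 𝔸) - 1‖ ≤ s₀) →
      ∀ e : PBond P i, e.src ∈ S → e.tgt ∈ S →
        AnalyticAt ℂ (fun A : PBond P 0 → 𝔸 => ((emlIterU i (expCfg η A) e : 𝔸ˣ) : 𝔸)) A₀ :=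
  fun i hi S A₀ s₀ hs₀ hbudget hA e hs ht =>
    analyticAt_coe_emlIterU_family_of_reads (fun A : PBond P 0 → 𝔸 => expCfg η A) A₀ (fun b => analyticAt_coe_expCfg η b A₀)
      i hi S s₀ hs₀ hbudget hA e hs ht

/-! ## §2  `chartLog` is analytic at near-flat base points; pointwise-to-`AnalyticOnNhd` -/

/-- `A ↦ chartLog η D A (j, c)` is analytic at `A₀` as soon as `A ↦ Ū^{(j)}(e^{iηA})(c)` is and `‖Ū^{(j)}(e^{iηA₀})(c) − 1‖ < 1` (the logarithm is analytic there,
`MatrixLog.analyticAt_mlog`). [cite: Balaban1985Variational, (156) p.302; Balaban1987RG1, (0.4) p.253] -/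
theorem analyticAt_chartLog_apply_of (η : ℝ) (D : Domains P) (idx : BondIdx D) {A₀ : PBond P 0 → 𝔸}
    (han : AnalyticAt ℂ (fun A : PBond P 0 → 𝔸 => ((emlIterU (idx.1.1 : ℕ) (expCfg η A) idx.1.2 : 𝔸ˣ) : 𝔸)) A₀)
    (hnear : ‖((emlIterU (idx.1.1 : ℕ) (expCfg η A₀) idx.1.2 : 𝔸ˣ) : 𝔸) - 1‖ < 1) :
    AnalyticAt ℂ (fun A : PBond P 0 → 𝔸 => chartLog η D A idx) A₀ := by
  have hfun : (fun A : PBond P 0 → 𝔸 => chartLog η D A idx) =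
      fun A => (-Complex.I) • mlog (((emlIterU (idx.1.1 : ℕ) (expCfg η A)) idx.1.2 : 𝔸ˣ) : 𝔸) := rfl
  rw [hfun]
  exact (AnalyticAt.comp (g := (mlog : 𝔸 → 𝔸)) (f := fun A : PBond P 0 → 𝔸 => ((emlIterU (idx.1.1 : ℕ) (expCfg η A) idx.1.2 : 𝔸ˣ) : 𝔸))
    (MatrixLog.analyticAt_mlog hnear) han).const_smul (c := -Complex.I)

/-- **AT AN INDEX `(j, c)`: `A ↦ chartLog η D A (j, c)` IS ANALYTIC AT EVERY `A₀` WHOSE CHARTED BOND VARIABLES ARE WITHIN `s₀` OF `1` ON THE READ SET,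
`6400ℓ²Lʲs₀ ≤ 1`** (§2 + the near-flatness half of `Prop8Chart.differentiableAt_chartLog_apply_of_reads`). [cite: Balaban1985Variational, (156) p.302; Balaban1987RG1, (0.21) p.256] -/
theorem analyticAt_chartLog_apply_of_reads [NormOneClass 𝔸] (η : ℝ) (D : Domains P) (idx : BondIdx D) (A₀ : PBond P 0 → 𝔸) {s₀ : ℝ} (hs₀ : 0 ≤ s₀)
    (hbudget : 6400 * (((P.d + 2) * P.L : ℕ) : ℝ) ^ 2 * (P.L : ℝ) ^ (idx.1.1 : ℕ) * s₀ ≤ 1)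
    (hA : ∀ b : PBond P 0, (iterBlockOf (idx.1.1 : ℕ) b.src = idx.1.2.src ∨ iterBlockOf (idx.1.1 : ℕ) b.src = idx.1.2.tgt) →
      (iterBlockOf (idx.1.1 : ℕ) b.tgt = idx.1.2.src ∨ iterBlockOf (idx.1.1 : ℕ) b.tgt = idx.1.2.tgt) → ‖((expCfg η A₀ b : 𝔸ˣ) : 𝔸) - 1‖ ≤ s₀) :
    AnalyticAt ℂ (fun A : PBond P 0 → 𝔸 => chartLog η D A idx) A₀ := by
  have hj : (idx.1.1 : ℕ) ≤ P.m + P.K := (Nat.lt_succ_iff.mp idx.1.1.isLt).trans D.hk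
  set S : Set (Site P (idx.1.1 : ℕ)) := {y | y = idx.1.2.src ∨ y = idx.1.2.tgt} with hS
  have hA' : ∀ b : PBond P 0, iterBlockOf (idx.1.1 : ℕ) b.src ∈ S → iterBlockOf (idx.1.1 : ℕ) b.tgt ∈ S →
      ‖((expCfg η A₀ b : 𝔸ˣ) : 𝔸) - 1‖ ≤ s₀ := fun b hs ht => hA b hs ht
  obtain ⟨-, hnear⟩ := differentiableAt_chartLog_apply_of_reads η D idx A₀ hs₀ hbudget hA
  have hℓ1 : (1 : ℝ) ≤ (((P.d + 2) * P.L : ℕ) : ℝ) := by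
    exact_mod_cast Nat.one_le_iff_ne_zero.mpr (Nat.mul_ne_zero (by omega) (by have := P.hL.2; omega))
  have hlt1 : ‖((emlIterU (idx.1.1 : ℕ) (expCfg η A₀) idx.1.2 : 𝔸ˣ) : 𝔸) - 1‖ < 1 := by
    refine hnear.trans_lt ?_
    have h0 : 0 ≤ (P.L : ℝ) ^ (idx.1.1 : ℕ) * s₀ := by positivity
    nlinarith [mul_nonneg h0 (by linarith : (0:ℝ) ≤ (((P.d + 2) * P.L : ℕ) : ℝ))]
  exact analyticAt_chartLog_apply_of η D idx
    (analyticAt_coe_emlIterU_of_reads η (idx.1.1 : ℕ) hj S A₀ s₀ hs₀ hbudget hA' idx.1.2 (Or.inl rfl) (Or.inr rfl)) hlt1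

/-- Pointwise-to-`AnalyticOnNhd` assembly over the finite index set (`analyticAt_pi_iff`). [folklore] -/
theorem analyticOnNhd_chartLog_of_forall (η : ℝ) (D : Domains P) {O : Set (PBond P 0 → 𝔸)}
    (h : ∀ A₀ ∈ O, ∀ idx : BondIdx D, AnalyticAt ℂ (fun A : PBond P 0 → 𝔸 => chartLog η D A idx) A₀) :
    AnalyticOnNhd ℂ (chartLog η D : (PBond P 0 → 𝔸) → BondIdx D → 𝔸) O :=
  fun A₀ hA₀ => analyticAt_pi_iff.mpr (h A₀ hA₀)

/-! ## §3  On the weighted ball: `chartLog η D` is ANALYTIC (hence `C^∞`) with the k-uniform radius of the hCd letter -/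

section Weighted

variable [NormOneClass 𝔸]

open Summit.QuantumFields.YangMills.Theorems.FlatCubeOpsText (Adm22)
open Summit.QuantumFields.YangMills.Theorems.K0FlatCubeOpsTextP (IsLevWeight)
open Summit.QuantumFields.YangMills.BalabanUVNodes.N07ChartRemainderP (norm_expCfg_sub_one_le_of_weightedBall)

/-- ★★ **THE CHARTED CONSTRAINT IS ANALYTIC ON THE WEIGHTED BALL**: for a nested family `D` with `D.k = k` and the collar property, the weights
`K0FlatCubeOpsTextP.IsLevWeight P k D w`, and every radius with `12800·ℓ²·L·R ≤ 1` (`ℓ = (d+2)L`; k-UNIFORM), `AnalyticOnNhd ℂ (chartLog η D) {Y | ∀ b, w 1 b·‖Y b‖ < R}`,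
`η = L^{−k}` — the analytic strengthening of `N07ChartRemainderP.differentiableOn_chartLog_weightedBall` (same reads, file 3's `norm_expCfg_sub_one_le_of_weightedBall`).
[cite: Balaban1985Variational, (44)-(48) p.285, Prop. 3 p.289 («defined and analytic»); Balaban1987RG1, (0.4) p.253] -/
theorem analyticOnNhd_chartLog_weightedBall (k : ℕ) (D : Domains P) (hDk : D.k = k)
    (hcollar : ∀ (i : ℕ) (e : PBond P (i + 1)), D.LamBond (i + 1) e → ∀ z : Site P i, (blockOf z = e.src ∨ blockOf z = e.tgt) → z ∈ D.Om i)
    {w : ℕ → PBond P 0 → ℝ} (hw : IsLevWeight P k D w) {R : ℝ} (hR : 12800 * (((P.d + 2) * P.L : ℕ) : ℝ) ^ 2 * (P.L : ℝ) * R ≤ 1) :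
    AnalyticOnNhd ℂ (chartLog (((P.L : ℝ)⁻¹) ^ k) D : (PBond P 0 → 𝔸) → BondIdx D → 𝔸) {Y | ∀ b, w 1 b * ‖Y b‖ < R} := by
  have hL1 : (1 : ℝ) ≤ P.L := by exact_mod_cast P.L_pos
  have hL0 : (0 : ℝ) < P.L := by linarith
  refine analyticOnNhd_chartLog_of_forall _ D fun A₀ hA₀ idx => ?_
  have hLj : 0 < (P.L : ℝ) ^ (idx.1.1 : ℕ) := by positivity
  have hR0 : 0 ≤ R := by
    have := hA₀ (⟨fun _ => 0, idx.1.2.dir⟩ : PBond P 0)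
    have hw0 : 0 ≤ w 1 ⟨fun _ => 0, idx.1.2.dir⟩ * ‖A₀ ⟨fun _ => 0, idx.1.2.dir⟩‖ := by
      rw [hw 1, pow_one]; exact mul_nonneg (by positivity) (norm_nonneg _)
    linarith
  set s₀ : ℝ := 2 * (P.L : ℝ) * R * ((P.L : ℝ) ^ (idx.1.1 : ℕ))⁻¹ with hs₀
  have hs₀0 : 0 ≤ s₀ := by positivity
  have hbudget : 6400 * (((P.d + 2) * P.L : ℕ) : ℝ) ^ 2 * (P.L : ℝ) ^ (idx.1.1 : ℕ) * s₀ ≤ 1 := by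
    have : 6400 * (((P.d + 2) * P.L : ℕ) : ℝ) ^ 2 * (P.L : ℝ) ^ (idx.1.1 : ℕ) * s₀ =
        12800 * (((P.d + 2) * P.L : ℕ) : ℝ) ^ 2 * (P.L : ℝ) * R := by
      rw [hs₀]; field_simp; ring
    rw [this]; exact hR
  have hA : ∀ b : PBond P 0, (iterBlockOf (idx.1.1 : ℕ) b.src = idx.1.2.src ∨ iterBlockOf (idx.1.1 : ℕ) b.src = idx.1.2.tgt) →
      (iterBlockOf (idx.1.1 : ℕ) b.tgt = idx.1.2.src ∨ iterBlockOf (idx.1.1 : ℕ) b.tgt = idx.1.2.tgt) →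
      ‖((expCfg (((P.L : ℝ)⁻¹) ^ k) A₀ b : 𝔸ˣ) : 𝔸) - 1‖ ≤ s₀ :=
    fun b hb _ => norm_expCfg_sub_one_le_of_weightedBall k D hDk hcollar hw hR hA₀ idx b hb
  exact analyticAt_chartLog_apply_of_reads _ D idx A₀ hs₀0 hbudget hA

/-- The same with the collar property discharged from (2.2)-admissibility (`Adm22 D R′ M`, `2L ≤ R′·M + 1`). [cite: Balaban1984PropagatorsII, (2.2) p.224; Balaban1985Variational, Prop. 3 p.289] -/
theorem analyticOnNhd_chartLog_weightedBall_of_adm22 (k : ℕ) (D : Domains P) (hDk : D.k = k) {R' M : ℕ}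
    (hAdm : Adm22 D R' M) (hRM : 2 * P.L ≤ R' * M + 1)
    {w : ℕ → PBond P 0 → ℝ} (hw : IsLevWeight P k D w) {R : ℝ} (hR : 12800 * (((P.d + 2) * P.L : ℕ) : ℝ) ^ 2 * (P.L : ℝ) * R ≤ 1) :
    AnalyticOnNhd ℂ (chartLog (((P.L : ℝ)⁻¹) ^ k) D : (PBond P 0 → 𝔸) → BondIdx D → 𝔸) {Y | ∀ b, w 1 b * ‖Y b‖ < R} :=
  analyticOnNhd_chartLog_weightedBall k D hDk (collar_of_adm22 D hAdm hRM) hw hR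

/-- ★ **`ContDiffOn ℂ m (chartLog η D)` ON THE WEIGHTED BALL FOR EVERY `m`** (analytic ⇒ smooth on complete spaces) — the `Inputs.contDiff` letter of lit-balaban's
`B11Prop3Model` for the TRUE constraint. [cite: Balaban1985Variational, Prop. 3 p.289, (70)-(73) p.289] -/
theorem contDiffOn_chartLog_weightedBall (k : ℕ) (D : Domains P) (hDk : D.k = k)
    (hcollar : ∀ (i : ℕ) (e : PBond P (i + 1)), D.LamBond (i + 1) e → ∀ z : Site P i, (blockOf z = e.src ∨ blockOf z = e.tgt) → z ∈ D.Om i)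
    {w : ℕ → PBond P 0 → ℝ} (hw : IsLevWeight P k D w) {R : ℝ} (hR : 12800 * (((P.d + 2) * P.L : ℕ) : ℝ) ^ 2 * (P.L : ℝ) * R ≤ 1) {m : WithTop ℕ∞} :
    ContDiffOn ℂ m (chartLog (((P.L : ℝ)⁻¹) ^ k) D : (PBond P 0 → 𝔸) → BondIdx D → 𝔸) {Y | ∀ b, w 1 b * ‖Y b‖ < R} :=
  (analyticOnNhd_chartLog_weightedBall k D hDk hcollar hw hR).contDiffOn_of_completeSpace

end Weighted

/-! ## §4  The (72)-letter `C₃`: the derivative of the charted constraint is LIPSCHITZ at the origin on the weighted ball (Cauchy estimate from analyticity) -/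

section DerivLipschitz

variable [NormOneClass 𝔸]

open Summit.QuantumFields.YangMills.Theorems.K0FlatCubeOpsTextP (IsLevWeight)
open Summit.QuantumFields.YangMills.BalabanUVNodes.N07ChartRemainderP (norm_chartLog_le_weightedBall)

/-- ★★ **THE (72)-LETTER FOR THE TRUE CONSTRAINT, k-UNIFORM**: for a nested family with the collar property, the weights `w`, a radius `R′ > 0` with
`12800ℓ²LR′ ≤ 1`, every `Y` of weighted size `≤ r` (`8r ≤ R′`) and every direction `W` of weighted size `≤ ρ`:
`‖(D chartLog(Y) − D chartLog(0)) W i‖ ≤ (3840ℓL∕R′)·ρ·r` at every index `i` — «|𝒞′ X| ≤ C₃|X₀||X|» ((72): the derivative of the nonlinear part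
`C = chartLog − D chartLog(0)` at `Y` applied to `W`), by `B7TransferAnalyticMean.norm_fderiv_sub_fderiv_le` on the analytic map of §4 read through the weighting
isomorphism `Z ↦ (w⁻¹·Z)` (sup ball of radius `R′` → weighted ball; bound `120ℓLR′` from file 3). [cite: Balaban1985Variational, (72)-(73) p.289; Balaban1985Averaging, Prop. 5 (156)-(157) p.42] -/
theorem norm_fderiv_chartLog_sub_fderiv_zero_le_weightedBall (k : ℕ) (D : Domains P) (hDk : D.k = k)
    (hcollar : ∀ (i : ℕ) (e : PBond P (i + 1)), D.LamBond (i + 1) e → ∀ z : Site P i, (blockOf z = e.src ∨ blockOf z = e.tgt) → z ∈ D.Om i)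
    {w : ℕ → PBond P 0 → ℝ} (hw : IsLevWeight P k D w) {R' : ℝ} (hR' : 12800 * (((P.d + 2) * P.L : ℕ) : ℝ) ^ 2 * (P.L : ℝ) * R' ≤ 1)
    (hR'0 : 0 < R') (Y W : PBond P 0 → 𝔸) {r ρ : ℝ} (hr0 : 0 ≤ r) (hr : 8 * r ≤ R') (hρ0 : 0 ≤ ρ)
    (hY : ∀ b, w 1 b * ‖Y b‖ ≤ r) (hW : ∀ b, w 1 b * ‖W b‖ ≤ ρ) (i : BondIdx D) :
    ‖(fderiv ℂ (chartLog (((P.L : ℝ)⁻¹) ^ k) D : (PBond P 0 → 𝔸) → BondIdx D → 𝔸) Y) W i -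
        (fderiv ℂ (chartLog (((P.L : ℝ)⁻¹) ^ k) D : (PBond P 0 → 𝔸) → BondIdx D → 𝔸) 0) W i‖ ≤
      3840 * (((P.d + 2) * P.L : ℕ) : ℝ) * (P.L : ℝ) / R' * ρ * r := by
  -- letters
  set η : ℝ := ((P.L : ℝ)⁻¹) ^ k with hη
  set ℓ : ℝ := (((P.d + 2) * P.L : ℕ) : ℝ) with hℓ
  have hwpos : ∀ b, 0 < w 1 b := fun b => by
    rw [hw 1 b, pow_one]
    have hL : (0 : ℝ) < P.L := by exact_mod_cast P.L_pos
    positivity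
  -- the weighting isomorphism and the preimages of `Y`, `W`
  set T : (PBond P 0 → 𝔸) →L[ℂ] (PBond P 0 → 𝔸) :=
    ContinuousLinearMap.pi fun b => ((w 1 b : ℂ)⁻¹) • ContinuousLinearMap.proj (R := ℂ) (φ := fun _ => 𝔸) b with hT
  have hT_apply : ∀ (Z : PBond P 0 → 𝔸) (b : PBond P 0), T Z b = ((w 1 b : ℂ)⁻¹) • Z b := fun Z b => rfl
  have hlift : ∀ (X : PBond P 0 → 𝔸) (t : ℝ), 0 ≤ t → (∀ b, w 1 b * ‖X b‖ ≤ t) →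
      ∃ Z : PBond P 0 → 𝔸, T Z = X ∧ ‖Z‖ ≤ t := by
    intro X t ht hX
    refine ⟨fun b => (w 1 b : ℂ) • X b, ?_, ?_⟩
    · funext b
      rw [hT_apply]
      simp only [smul_smul]
      rw [inv_mul_cancel₀ (by exact_mod_cast (hwpos b).ne'), one_smul]
    · refine (pi_norm_le_iff_of_nonneg ht).2 fun b => ?_
      simp only [norm_smul, Complex.norm_real, Real.norm_eq_abs, abs_of_pos (hwpos b)]
      exact hX b
  obtain ⟨Z, hTZ, hZnorm⟩ := hlift Y r hr0 hY
  obtain ⟨V, hTV, hVnorm⟩ := hlift W ρ hρ0 hW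
  -- the component map through the weighting
  set g : (PBond P 0 → 𝔸) → 𝔸 := fun A => chartLog η D A i with hg
  set Φ : (PBond P 0 → 𝔸) → 𝔸 := fun X => g (T X) with hΦ
  have hmaps : ∀ X : PBond P 0 → 𝔸, X ∈ ball (0 : PBond P 0 → 𝔸) R' → ∀ b, w 1 b * ‖T X b‖ < R' := by
    intro X hX b
    rw [mem_ball_zero_iff] at hX
    rw [hT_apply, norm_smul, norm_inv, Complex.norm_real, Real.norm_eq_abs, abs_of_pos (hwpos b), ← mul_assoc,
      mul_inv_cancel₀ (hwpos b).ne', one_mul]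
    exact (norm_le_pi_norm X b).trans_lt hX
  have han := analyticOnNhd_chartLog_weightedBall (𝔸 := 𝔸) k D hDk hcollar hw hR'
  have hgA : ∀ X ∈ ball (0 : PBond P 0 → 𝔸) R', AnalyticAt ℂ g (T X) := fun X hX =>
    analyticAt_pi_iff.mp (han (T X) (hmaps X hX)) i
  have hΦA : AnalyticOnNhd ℂ Φ (ball (0 : PBond P 0 → 𝔸) R') := fun X hX =>
    AnalyticAt.comp (g := g) (f := fun X => T X) (hgA X hX) (T.analyticAt X)
  have hΦB : ∀ X ∈ ball (0 : PBond P 0 → 𝔸) R', ‖Φ X‖ ≤ 120 * ℓ * (P.L : ℝ) * R' := fun X hX =>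
    norm_chartLog_le_weightedBall k D hDk hcollar hw hR' (hmaps X hX) i
  -- the Cauchy estimate for the derivative difference
  have hZ8 : ‖Z - 0‖ ≤ R' / 8 := by rw [sub_zero]; linarith
  have hC := B7TransferAnalyticMean.norm_fderiv_sub_fderiv_le (x₀ := (0 : PBond P 0 → 𝔸)) hR'0 hΦA hΦB hZ8 V
  rw [sub_zero] at hC
  -- chain rule through `T`: `DΦ(X) V = D g(T X) (T V)`
  have hchain : ∀ X ∈ ball (0 : PBond P 0 → 𝔸) R', fderiv ℂ Φ X V =
      (fderiv ℂ (chartLog η D : (PBond P 0 → 𝔸) → BondIdx D → 𝔸) (T X)) (T V) i := by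
    intro X hX
    have hgd : DifferentiableAt ℂ g (T X) := (hgA X hX).differentiableAt
    have h1 : fderiv ℂ Φ X = (fderiv ℂ g (T X)).comp T := by
      rw [hΦ]; exact fderiv_comp X hgd T.differentiableAt |>.trans (by rw [T.fderiv])
    have hcd : DifferentiableAt ℂ (chartLog η D : (PBond P 0 → 𝔸) → BondIdx D → 𝔸) (T X) :=
      (han (T X) (hmaps X hX)).differentiableAt
    have h2 : fderiv ℂ g (T X) = (ContinuousLinearMap.proj (R := ℂ) (φ := fun _ : BondIdx D => 𝔸) i).comp
        (fderiv ℂ (chartLog η D : (PBond P 0 → 𝔸) → BondIdx D → 𝔸) (T X)) :=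
      ((hasFDerivAt_pi'.mp hcd.hasFDerivAt) i).fderiv
    rw [h1, ContinuousLinearMap.comp_apply, h2, ContinuousLinearMap.comp_apply, ContinuousLinearMap.proj_apply]
  have hZball : Z ∈ ball (0 : PBond P 0 → 𝔸) R' := by rw [mem_ball_zero_iff]; linarith
  have h0ball : (0 : PBond P 0 → 𝔸) ∈ ball (0 : PBond P 0 → 𝔸) R' := mem_ball_self hR'0
  rw [hchain Z hZball, hchain 0 h0ball, map_zero, hTZ, hTV] at hC
  refine hC.trans ?_
  -- `32·(120ℓLR′)·‖V‖·‖Z‖/R′² ≤ (3840ℓL/R′)·ρ·r`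
  have hℓ0 : 0 ≤ ℓ := Nat.cast_nonneg _
  have hL0 : (0 : ℝ) ≤ P.L := Nat.cast_nonneg _
  have heq : 32 * (120 * ℓ * (P.L : ℝ) * R') * ‖V‖ * ‖Z‖ / R' ^ 2 = 3840 * ℓ * (P.L : ℝ) / R' * ‖V‖ * ‖Z‖ := by
    field_simp
    ring
  rw [heq]
  have hV0 : 0 ≤ ‖V‖ := norm_nonneg _
  have hZ0 : 0 ≤ ‖Z‖ := norm_nonneg _
  have hc0 : 0 ≤ 3840 * ℓ * (P.L : ℝ) / R' := by positivity
  calc 3840 * ℓ * (P.L : ℝ) / R' * ‖V‖ * ‖Z‖ ≤ 3840 * ℓ * (P.L : ℝ) / R' * ρ * r := by gcongr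

end DerivLipschitz

end Summit.QuantumFields.YangMills.BalabanUVNodes.N07ChartLogAnalytic

end
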